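import Literature.AnabelianGeometry.SemiGraphs.ProfiniteFreeTwoElevation
import Literature.AnabelianGeometry.SemiGraphs.OneVertexCuspsAction
import Literature.AnabelianGeometry.SemiGraphs.CuspCosetIndex
import Literature.AnabelianGeometry.SemiGraphs.TemperedCuspidalAbsolutenessLeafCuspedFrame
import Literature.AnabelianGeometry.SemiGraphs.CharacteristicOpenCore
import Literature.AnabelianGeometry.SemiGraphs.TemperedSpecialFibreTowerFreeProfiniteWitness
import Literature.AnabelianGeometry.SemiGraphs.TemperedSpecialFibreTower
import HarnessLib

/-!
# NON-VACUITY WITH CUSPS of the levelwise cusp–graph binder `hLG` of [SemiAnbd] Thm. 6.5 (iii)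
# «follows from Corollary 3.11»: an Example 3.10 tower with CUSPED fibres over the saturated `F̂₂` datum

Mochizuki, *Semi-graphs of anabelioids*, Publ. RIMS **42** (2006) [SemiAnbd], Thm. 6.5 (iii) p. 72 («Assertion
(iii) follows from Corollary 3.11»), Cor. 3.11 pp. 45–47, Ex. 3.10 p. 44 («an exhaustive sequence of open
characteristic subgroups … `N_i` … semi-graphs of anabelioids `𝒢_i`, `𝒢^c_i` on which `Δ_i` acts faithfully»),
§6 p. 71 («`I_x = D_x ∩ Δ^temp_X`») [cite: MochizukiSemiAnbd2006, Thm 6.5(iii) p.72].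

PROOF-ONLY file (abc-iut cell, layer L3, seat abc-iut-L3-t11 gen 6, row «NV-hLG@cusped» /
«CUSP-ABS·NONDEGENERATE-NV», the ASSEMBLY (B4b); no definition, no instance, no named fact).  Seat gen 5 REDUCED
the Cor. 3.11 leaf `h311` of Thm. 6.5 (iii) (GAP G-L3d2g4-1) to the levelwise cusp–graph binder `hLG`
(`TemperedCuspidalAbsolutenessOfProCusps.lean`, p462521) and certified `hLG` only at a CUSPLESS datum (p463530, cusp
clauses vacuous).  Here `hLG` is certified at a datum WITH CUSPS, every clause non-vacuous:

* `TemperedOrigin.exists_principal_levelwiseCuspGraphIso_cusped` — at the principal certificate of the saturated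
  `F̂₂` datum (`TemperedCurve.exists_saturatedCusps_framed`: `Π^temp = G_{ℚ_p} × F̂₂`, all automorphism-translates
  of `îa(Ẑ)` as cusps), for every `γ : Δ^temp ⥲ Δ^temp` the binder's data EXIST: the tower has levels the
  characteristic open cores `N_i` of `F̂₂` (abc-iut-w4-d053) transported to `Δ^temp`, fibre `i` = the one-vertex
  semi-graph of anabelioids with vertex group `N_i` and CUSPS indexed by the coset index of `F̂₂/N_i`
  (`CuspCoset.Index`) carrying the twisted cusp groups `cl η⟨a b^k⟩ ∩ N_i` (Thm. 3.7 hypotheses: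
  `TwistedCusps.restrict_thm37Hypotheses_cusp`; chart with `π₁^temp = N_i` on the nose: `OneVertexCusps.restrictChart`;
  admissible quotient = the identity, faithfulness from slimness), the `Π^temp`-actions are left translation on
  the coset index through the retraction `Π^temp → Δ^temp` (`OneVertexCusps.permAutHom ∘ CuspCoset.act`), the edge
  under a cusp `x` at level `i` is the base point of the image of `I_x ∩ Δ^temp` in `F̂₂/N_i` (so «`g` fixes it at
  every level» ⟺ `g ∈ ⋂_i (I_x ∩ Δ^temp)·N_i = I_x ∩ Δ^temp`, `CuspCoset.mem_of_forall_mem_sup`), and the levelwise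
  isomorphisms are the permutations induced by `γ` on the quotients (`CuspCoset.autPerm`; equivariance
  `autPerm_act`, cusp matching `autPerm_basePt` + SATURATION of the cusp set).

HONEST LABEL: consistency evidence for the joint satisfiability of ALL clauses of `hLG` (tower / action / pro-cusp
reading / equivariance / cusp matching) at ONE datum with cusps and non-abelian slim `Δ^temp`; the datum is not a
curve (compact direct-product `Π^temp`, automorphism-saturated cusp set).  Nothing of [SemiAnbd] is asserted; no
side is taken on [IUTchIII] Cor. 3.12.
-/

noncomputable section

namespace Literature.AnabelianGeometry.SemiGraphs

open CategoryTheory Topology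
open scoped Pointwise
open Literature.IUT.HodgeTheaters (profiniteCompletion toCompletion)
open Literature.AlgebraicGeometry.Frobenioids (IsSlimGroup)
open ProfiniteSemiGraph

/-! ### Bookkeeping (private) -/

/-- Slimness is transported along isomorphisms of topological groups. [cite: MochizukiSemiAnbd2006, §0 p.6] -/
private theorem isSlimGroup_of_continuousMulEquiv_binder {G₁ G₂ : Type*} [Group G₁] [TopologicalSpace G₁]
    [Group G₂] [TopologicalSpace G₂] (e : G₁ ≃ₜ* G₂) (h : IsSlimGroup G₁) : IsSlimGroup G₂ := by
  refine ⟨fun H hH => ?_⟩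
  refine (Subgroup.eq_bot_iff_forall _).mpr fun z hz => ?_
  have hH' : IsOpen ((H.comap e.toMulEquiv.toMonoidHom : Subgroup G₁) : Set G₁) := hH.preimage e.continuous
  have hz' : e.symm z ∈ Subgroup.centralizer ((H.comap e.toMulEquiv.toMonoidHom : Subgroup G₁) : Set G₁) := by
    refine Subgroup.mem_centralizer_iff.mpr fun g hg => ?_
    have := Subgroup.mem_centralizer_iff.mp hz (e g) hg
    apply e.injective
    simpa [map_mul] using this
  rw [h.centralizer_eq_bot _ hH'] at hz'
  have : e.symm z = 1 := Subgroup.mem_bot.mp hz'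
  simpa using congrArg e this

/-- For a normal subgroup `L`, `ȳ ∈ H̄ = H·L/L` iff `y ∈ H ⊔ L`. [cite: MochizukiSemiAnbd2006, Ex 3.10 p.44] -/
private theorem mk_mem_map_mk_iff {G : Type*} [Group G] (L H : Subgroup G) [L.Normal] (y : G) :
    QuotientGroup.mk' L y ∈ H.map (QuotientGroup.mk' L) ↔ y ∈ H ⊔ L := by
  constructor
  · rintro ⟨h, hh, hhy⟩
    have : h⁻¹ * y ∈ L := QuotientGroup.eq.mp hhy
    have hy : y = h * (h⁻¹ * y) := by group
    rw [hy]
    exact Subgroup.mul_mem _ (Subgroup.mem_sup_left hh) (Subgroup.mem_sup_right this)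
  · intro hy
    rw [← SetLike.mem_coe, Subgroup.mul_normal H L] at hy
    obtain ⟨h, hh, l, hl, rfl⟩ := Set.mem_mul.mp hy
    refine ⟨h, hh, ?_⟩
    have hl1 : QuotientGroup.mk' L l = 1 := (QuotientGroup.eq_one_iff l).mpr hl
    rw [map_mul, hl1, mul_one]

namespace TemperedOrigin

/-- **NON-VACUITY WITH CUSPS of the binder `hLG`** of `inertiaLeaf_of_levelwiseCuspGraphIso` /
`cuspidalAbsolutenessHolds_of_levelwiseCuspGraphIso` (gen 5, p462521): at the principal certificate `Ω := (· = X)` of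
the saturated `F̂₂` datum — which HAS CUSPS — for every `γ : Δ^temp ⥲ Δ^temp` there are towers, actions, pro-cusp
edge systems and `γ`-equivariant levelwise isomorphisms matching the cusps, exactly as the binder demands.
Consistency evidence only; not a curve. [cite: MochizukiSemiAnbd2006, Thm 6.5(iii) p.72] -/
theorem exists_principal_levelwiseCuspGraphIso_cusped (p : ℕ) [Fact p.Prime] :
    ∃ (X : TemperedCurve p) (Ω : TemperedOrigin p), (∀ Y, Ω.IsHyperbolicCurveOrigin Y ↔ Y = X) ∧
      (∃ x : X.Pt, X.IsCusp x) ∧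
      ∀ X' Y' : TemperedCurve p, Ω.IsHyperbolicCurveOrigin X' → Ω.IsHyperbolicCurveOrigin Y' →
      ∀ γ : X'.DeltaTemp ≃ₜ* Y'.DeltaTemp,
      ∃ (TX : SpecialFibreTower X'.DeltaTemp) (TY : SpecialFibreTower Y'.DeltaTemp)
        (AX : ∀ i, X'.PiTemp →* Aut (TX.Gc i).graph) (AY : ∀ i, Y'.PiTemp →* Aut (TY.Gc i).graph)
        (cX : ∀ i, {x : X'.Pt // X'.IsCusp x} → (TX.Gc i).graph.Edge)
        (cY : ∀ i, {y : Y'.Pt // Y'.IsCusp y} → (TY.Gc i).graph.Edge)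
        (FI : ∀ i, (TX.Gc i).graph ≅ (TY.Gc i).graph),
        (∀ (x : {x : X'.Pt // X'.IsCusp x}) (g : X'.DeltaTemp), (g : X'.PiTemp) ∈ X'.inertia x.1 ↔
            ∀ i, (AX i (g : X'.PiTemp)).hom.edgeMap (cX i x) = cX i x) ∧
        (∀ (y : {y : Y'.Pt // Y'.IsCusp y}) (h : Y'.DeltaTemp), (h : Y'.PiTemp) ∈ Y'.inertia y.1 ↔
            ∀ i, (AY i (h : Y'.PiTemp)).hom.edgeMap (cY i y) = cY i y) ∧
        (∀ (i) (g : X'.DeltaTemp) (e : (TX.Gc i).graph.Edge),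
            (FI i).hom.edgeMap ((AX i (g : X'.PiTemp)).hom.edgeMap e) =
              (AY i ((γ g : Y'.DeltaTemp) : Y'.PiTemp)).hom.edgeMap ((FI i).hom.edgeMap e)) ∧
        (∀ x : {x : X'.Pt // X'.IsCusp x}, ∃ (y : {y : Y'.Pt // Y'.IsCusp y}) (δ : Y'.PiTemp),
            ∀ i, (FI i).hom.edgeMap (cX i x) = (AY i δ).hom.edgeMap (cY i y)) := by
  classical
  obtain ⟨X, r, ⟨e⟩, hr, ⟨x₀⟩, hcusp, hIcl, hsat⟩ := TemperedCurve.exists_saturatedCusps_framed p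
  refine ⟨X, ⟨fun Y => Y = X⟩, fun Y => Iff.rfl, ⟨x₀, hcusp x₀⟩, ?_⟩
  intro X' Y' hX' hY' γ
  cases hX'
  cases hY'
  /- ### (0) the base `F := F̂₂`, its characteristic open cores `L n`, and the tower levels `N n ≤ Δ^temp` -/
  haveI hsc : SecondCountableTopology (profiniteCompletion (FreeGroup (Fin 2))) :=
    secondCountableTopology_profiniteCompletion_freeGroup (Fin 2)
  haveI : CompactSpace X.DeltaTemp := e.toHomeomorph.compactSpace
  have htfg := isTopologicallyFinitelyGenerated_profiniteCompletion_freeGroupTwo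
  obtain ⟨hanti, hlev, hcof⟩ := charOpenCore_family_of_tfg (Γ := profiniteCompletion (FreeGroup (Fin 2))) htfg
  let L : ℕ → Subgroup (profiniteCompletion (FreeGroup (Fin 2))) :=
    charOpenCore (profiniteCompletion (FreeGroup (Fin 2)))
  haveI hLn : ∀ n, (L n).Normal := fun n => (hlev n).2.1
  have hLo : ∀ n, IsOpen (L n : Set (profiniteCompletion (FreeGroup (Fin 2)))) := fun n => (hlev n).1
  have hLc : ∀ n, IsClosed (L n : Set (profiniteCompletion (FreeGroup (Fin 2)))) :=
    fun n => (L n).isClosed_of_isOpen (hLo n)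
  haveI hLf : ∀ n, (L n).FiniteIndex := fun n => (hlev n).2.2.1
  have hLchar : ∀ (n) (ψ : profiniteCompletion (FreeGroup (Fin 2)) ≃ₜ* profiniteCompletion (FreeGroup (Fin 2))),
      (L n).map ψ.toMulEquiv.toMonoidHom = L n :=
    fun n ψ => (hlev n).2.2.2 ψ.toMulEquiv ψ.continuous ψ.symm.continuous
  -- every neighbourhood of `1` contains some `L n`
  have hLbasis : ∀ U : Set (profiniteCompletion (FreeGroup (Fin 2))), IsOpen U → (1 : _) ∈ U →
      ∃ n, (L n : Set _) ⊆ U := by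
    intro U hU h1
    obtain ⟨H, hH⟩ := ProfiniteGrp.exist_openNormalSubgroup_sub_open_nhds_of_one hU h1
    haveI : Finite (profiniteCompletion (FreeGroup (Fin 2)) ⧸ H.toSubgroup) :=
      H.toSubgroup.quotient_finite_of_isOpen H.isOpen
    haveI : H.toSubgroup.FiniteIndex := Subgroup.finiteIndex_of_finite_quotient
    obtain ⟨n, hn⟩ := hcof H.toSubgroup H.isOpen inferInstance
    exact ⟨n, fun g hg => hH (hn hg)⟩
  have hLexh : ∀ g : profiniteCompletion (FreeGroup (Fin 2)), (∀ n, g ∈ L n) → g = 1 := by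
    intro g hg
    by_contra hne
    obtain ⟨n, hn⟩ := hLbasis {g}ᶜ isOpen_compl_singleton (by simpa using fun h => hne h.symm)
    exact hn (hg n) rfl
  -- the levels on `Δ^temp`
  let N : ℕ → Subgroup X.DeltaTemp := fun n => (L n).map e.toMulEquiv.toMonoidHom
  have hNmem : ∀ n (g : X.DeltaTemp), g ∈ N n ↔ e.symm g ∈ L n := fun n g => Subgroup.mem_map_equiv
  have hNopen : ∀ n, IsOpen (N n : Set X.DeltaTemp) := fun n => by
    have : (N n : Set X.DeltaTemp) = e.symm ⁻¹' (L n : Set _) := by ext g; exact hNmem n g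
    rw [this]; exact (hLo n).preimage e.symm.continuous
  /- ### (1) slimness of `Δ^temp`, the edge indices and the fibres -/
  have hslimΔ : IsSlimGroup X.DeltaTemp :=
    isSlimGroup_of_continuousMulEquiv_binder e isSlimGroup_profiniteCompletion_freeGroupTwo
  -- the edge index of level `n` and an injective enumeration into `ℤ`
  let ι : ℕ → Type := fun n => CuspCoset.Index (profiniteCompletion (FreeGroup (Fin 2)) ⧸ L n)
  haveI hιfin : ∀ n, Finite (ι n) := fun n => by
    haveI : Finite (profiniteCompletion (FreeGroup (Fin 2)) ⧸ L n) := (L n).quotient_finite_of_isOpen (hLo n)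
    exact CuspCoset.Index.finite
  have hemb : ∀ n, ∃ c : ι n → ℤ, Function.Injective c := fun n => by
    obtain ⟨m, ⟨f⟩⟩ := Finite.exists_equiv_fin (ι n)
    refine ⟨fun k => ((f k : ℕ) : ℤ), fun a b h => ?_⟩
    have h' : ((f a : ℕ) : ℤ) = ((f b : ℕ) : ℤ) := h
    exact f.injective (Fin.ext (by exact_mod_cast h'))
  choose c hc using hemb
  -- the fibres (one vertex `L n`, cusps `cl η⟨a b^{c k}⟩ ∩ L n`), their Thm 3.7 hypotheses and charts
  let Gc : ℕ → ProfiniteSemiGraph.{0} := fun n =>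
    OneVertexCusps.restrictGraph (L n) (fun k : ι n => TwistedCusps.cusp (c n k)) (hLc n)
      (fun k => TwistedCusps.isClosed_cusp (c n k))
  have hyp : ∀ n, (Gc n).Thm37Hypotheses := fun n =>
    TwistedCusps.restrict_thm37Hypotheses_cusp (L n) (hLo n) (c n) (hc n)
  let chart : ∀ n, TemperedPiChart (Gc n) := fun n =>
    OneVertexCusps.restrictChart (L n) (fun k : ι n => TwistedCusps.cusp (c n k)) (hLc n)
      (fun k => TwistedCusps.isClosed_cusp (c n k))
  -- the admissible quotients `N n ⥲ L n` (restrictions of `e⁻¹`)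
  let admH : ∀ n, ↥(N n) ≃ₜ ↥(L n) := fun n =>
    e.symm.toHomeomorph.subtype (p := fun g => g ∈ N n) (q := fun g => g ∈ L n) (fun g => hNmem n g)
  let adm : ∀ n, ↥(N n) →ₜ* (chart n).G := fun n =>
    { toFun := fun g => ⟨e.symm g.1, (hNmem n g.1).1 g.2⟩
      map_one' := by
        apply Subtype.ext
        change e.symm ((1 : ↥(N n)) : X.DeltaTemp) = ((1 : ↥(L n)) : profiniteCompletion (FreeGroup (Fin 2)))
        simp
      map_mul' := fun g h => by
        apply Subtype.ext
        change e.symm ((g * h : ↥(N n)) : X.DeltaTemp) =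
          ((⟨e.symm g.1, (hNmem n g.1).1 g.2⟩ * ⟨e.symm h.1, (hNmem n h.1).1 h.2⟩ : ↥(L n)) :
            profiniteCompletion (FreeGroup (Fin 2)))
        simp
      continuous_toFun := (admH n).continuous }
  have hadm_surj : ∀ n, Function.Surjective (adm n) := fun n y =>
    ⟨⟨e y.1, (hNmem n _).2 (by rw [ContinuousMulEquiv.symm_apply_apply]; exact y.2)⟩, by
      apply Subtype.ext
      change e.symm (e y.1) = y.1
      rw [ContinuousMulEquiv.symm_apply_apply]⟩
  /- ### (2) the tower -/
  let T : SpecialFibreTower X.DeltaTemp :=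
    { N := N
      N_antitone := fun n m h => Subgroup.map_mono (hanti h)
      isOpen_N := hNopen
      N_char := fun n φ => by
        let ψ : profiniteCompletion (FreeGroup (Fin 2)) ≃ₜ* profiniteCompletion (FreeGroup (Fin 2)) :=
          e.trans (φ.trans e.symm)
        have hψ := hLchar n ψ
        change ((L n).map e.toMulEquiv.toMonoidHom).map φ.toMulEquiv.toMonoidHom = (L n).map e.toMulEquiv.toMonoidHom
        conv_rhs => rw [← hψ]
        rw [Subgroup.map_map, Subgroup.map_map]
        congr 1
        refine MonoidHom.ext fun g => ?_
        change φ (e g) = e (e.symm (φ (e g)))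
        rw [ContinuousMulEquiv.apply_symm_apply]
      N_normal := fun n => (hLn n).map _ e.surjective
      N_finiteIndex := fun n => by
        haveI : Finite (X.DeltaTemp ⧸ N n) := (N n).quotient_finite_of_isOpen (hNopen n)
        exact Subgroup.finiteIndex_of_finite_quotient
      N_exhaustive := fun g hg => by
        have : e.symm g = 1 := hLexh _ fun n => (hNmem n g).1 (hg n)
        simpa using congrArg e this
      Gc := Gc
      hyp := hyp
      chart := chart
      admKer := fun _ => ⊥
      admKer_le := fun _ => bot_le
      admKer_normal := fun _ => inferInstance
      admKer_antitone := fun _ _ _ => le_rfl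
      adm := adm
      adm_surjective := hadm_surj
      isOpenMap_adm := fun n => (admH n).isOpenMap
      ker_adm := fun n => by
        rw [Subgroup.bot_subgroupOf]
        refine (MonoidHom.ker_eq_bot_iff _).mpr fun g h hgh => ?_
        have := congrArg (fun z : ↥(L n) => (z : profiniteCompletion (FreeGroup (Fin 2)))) hgh
        exact Subtype.ext (e.symm.injective this)
      faithful := fun n g hg => by
        have hcen : g ∈ Subgroup.centralizer (N n : Set X.DeltaTemp) := by
          rw [Subgroup.mem_centralizer_iff]
          intro m hm
          have h1 : g * m * g⁻¹ * m⁻¹ = 1 := Subgroup.mem_bot.mp (hg m hm)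
          calc m * g = (g * m * g⁻¹ * m⁻¹)⁻¹ * (g * m) := by group
            _ = g * m := by rw [h1, inv_one, one_mul]
        rw [hslimΔ.centralizer_eq_bot _ (hNopen n)] at hcen
        rw [Subgroup.mem_bot.mp hcen]
        exact (N n).one_mem }
  /- ### (3) actions, pro-cusps, levelwise isomorphisms -/
  let Q : ℕ → Type := fun n => profiniteCompletion (FreeGroup (Fin 2)) ⧸ L n
  let q : ∀ n, X.DeltaTemp →* Q n := fun n => (QuotientGroup.mk' (L n)).comp e.symm.toMulEquiv.toMonoidHom
  let A : ∀ n, X.PiTemp →* Aut (T.Gc n).graph := fun n =>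
    (OneVertexCusps.permAutHom (ι n)).comp ((CuspCoset.act (Q n)).comp ((q n).comp r))
  -- the image `H' x ≤ F̂₂` of `I_x ∩ Δ^temp` and its level images
  let H' : X.Pt → Subgroup (profiniteCompletion (FreeGroup (Fin 2))) := fun x =>
    ((X.inertia x).subgroupOf X.DeltaTemp).map e.symm.toMulEquiv.toMonoidHom
  have hH'mem : ∀ x (g : X.DeltaTemp), e.symm g ∈ H' x ↔ (g : X.PiTemp) ∈ X.inertia x := fun x g => by
    constructor
    · rintro ⟨z, hz, hzg⟩
      have hzg' : z = g := e.symm.injective hzg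
      subst hzg'
      exact Subgroup.mem_subgroupOf.mp hz
    · intro hg
      exact Subgroup.mem_map_of_mem _ (Subgroup.mem_subgroupOf.mpr hg)
  have hH'closed : ∀ x, IsClosed (H' x : Set (profiniteCompletion (FreeGroup (Fin 2)))) := fun x => by
    have hc : IsClosed (((X.inertia x).subgroupOf X.DeltaTemp : Subgroup X.DeltaTemp) : Set X.DeltaTemp) := by
      rw [Subgroup.coe_subgroupOf]; exact (hIcl x).preimage continuous_subtype_val
    have : (H' x : Set (profiniteCompletion (FreeGroup (Fin 2)))) =
        e.symm '' (((X.inertia x).subgroupOf X.DeltaTemp : Subgroup X.DeltaTemp) : Set X.DeltaTemp) :=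
      Subgroup.coe_map _ _
    rw [this]
    exact e.symm.toHomeomorph.isClosedMap _ hc
  let S : ∀ n, X.Pt → Subgroup (Q n) := fun n x => (H' x).map (QuotientGroup.mk' (L n))
  let cX : ∀ n, {x : X.Pt // X.IsCusp x} → (T.Gc n).graph.Edge := fun n x => CuspCoset.basePt (Q n) (S n x.1)
  -- `γ` transported to `F̂₂` and to the finite levels
  let γ' : profiniteCompletion (FreeGroup (Fin 2)) ≃ₜ* profiniteCompletion (FreeGroup (Fin 2)) :=
    e.trans (γ.trans e.symm)
  have hγ'L : ∀ n, (L n).map (γ'.toMulEquiv : profiniteCompletion (FreeGroup (Fin 2)) →*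
      profiniteCompletion (FreeGroup (Fin 2))) = L n := fun n => hLchar n γ'
  let γbar : ∀ n, Q n ≃* Q n := fun n => QuotientGroup.congr (L n) (L n) γ'.toMulEquiv (hγ'L n)
  let FI : ∀ n, (T.Gc n).graph ≅ (T.Gc n).graph := fun n => OneVertexCusps.permAut (CuspCoset.autPerm (γbar n))
  -- how `γ'` and `γbar` relate to `γ`
  have hγ'e : ∀ g : X.DeltaTemp, γ' (e.symm g) = e.symm (γ g) := fun g => by
    change e.symm (γ (e (e.symm g))) = _
    rw [ContinuousMulEquiv.apply_symm_apply]
  have hγbar_q : ∀ n (g : X.DeltaTemp), γbar n (q n g) = q n (γ g) := fun n g => by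
    change QuotientGroup.congr (L n) (L n) γ'.toMulEquiv (hγ'L n) (QuotientGroup.mk' (L n) (e.symm g)) =
      QuotientGroup.mk' (L n) (e.symm (γ g))
    rw [QuotientGroup.congr_mk', ← hγ'e]
    rfl
  /- ### (4) the clauses -/
  -- the stabiliser reading at one level, and the pro-cusp reading
  have hfix : ∀ n (x : X.Pt) (g : X.DeltaTemp),
      (A n (g : X.PiTemp)).hom.edgeMap (CuspCoset.basePt (Q n) (S n x)) = CuspCoset.basePt (Q n) (S n x) ↔
        e.symm g ∈ H' x ⊔ L n := by
    intro n x g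
    change CuspCoset.act (Q n) (q n (r g)) (CuspCoset.basePt (Q n) (S n x)) = _ ↔ _
    rw [CuspCoset.act_basePt_eq_iff, hr]
    exact mk_mem_map_mk_iff (L n) (H' x) (e.symm g)
  have hclause : ∀ (x : {x : X.Pt // X.IsCusp x}) (g : X.DeltaTemp),
      (g : X.PiTemp) ∈ X.inertia x.1 ↔ ∀ n, (A n (g : X.PiTemp)).hom.edgeMap (cX n x) = cX n x := by
    intro x g
    constructor
    · intro hg n
      exact (hfix n x.1 g).2 (Subgroup.mem_sup_left ((hH'mem x.1 g).2 hg))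
    · intro h
      have h' : ∀ n, e.symm g ∈ H' x.1 ⊔ L n := fun n => (hfix n x.1 g).1 (h n)
      exact (hH'mem x.1 g).1 (CuspCoset.mem_of_forall_mem_sup (H' x.1) (hH'closed x.1) L hLbasis h')
  refine ⟨T, T, A, A, cX, cX, FI, hclause, hclause, ?_, ?_⟩
  · -- equivariance
    intro n g edge
    change CuspCoset.autPerm (γbar n) (CuspCoset.act (Q n) (q n (r g)) edge) =
      CuspCoset.act (Q n) (q n (r (γ g))) (CuspCoset.autPerm (γbar n) edge)
    rw [CuspCoset.autPerm_act, hr, hr, hγbar_q]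
  · -- cusp matching: `y` from SATURATION, `δ = 1`
    intro x
    obtain ⟨y, hy⟩ := hsat γ x.1
    refine ⟨⟨y, hcusp y⟩, 1, fun n => ?_⟩
    rw [map_one]
    change CuspCoset.autPerm (γbar n) (CuspCoset.basePt (Q n) (S n x.1)) = CuspCoset.basePt (Q n) (S n y)
    rw [CuspCoset.autPerm_basePt]
    congr 1
    -- `γbar (S n x) = S n y`
    change ((H' x.1).map (QuotientGroup.mk' (L n))).map (γbar n).toMonoidHom =
      (H' y).map (QuotientGroup.mk' (L n))
    have hnat : (γbar n).toMonoidHom.comp (QuotientGroup.mk' (L n)) =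
        (QuotientGroup.mk' (L n)).comp (γ'.toMulEquiv : profiniteCompletion (FreeGroup (Fin 2)) →* _) := by
      ext g
      exact QuotientGroup.congr_mk' (L n) (L n) γ'.toMulEquiv (hγ'L n) g
    have hHy : (H' x.1).map (γ'.toMulEquiv : profiniteCompletion (FreeGroup (Fin 2)) →* _) = H' y := by
      change (((X.inertia x.1).subgroupOf X.DeltaTemp).map e.symm.toMulEquiv.toMonoidHom).map _ =
        ((X.inertia y).subgroupOf X.DeltaTemp).map e.symm.toMulEquiv.toMonoidHom
      rw [← hy, Subgroup.map_map, Subgroup.map_map]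
      congr 1
      ext g
      exact hγ'e g
    rw [Subgroup.map_map, hnat, ← Subgroup.map_map, hHy]

end TemperedOrigin

end Literature.AnabelianGeometry.SemiGraphs

end
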